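import Literature.Analysis.FunctionSpaces.BesselIGeneratingFunction
import Literature.Probability.LatticeModels.GinibreBesselBounds
import Literature.Probability.LatticeModels.BesselIRatioBounds
import HarnessLib

/-!
# The integral `I_n(x) = π⁻¹∫₀^π e^{x cos θ} cos(nθ) dθ` IS the power series `Σ_k (x/2)^{2k+n}/(k!(k+n)!)`: the tree's two modified Bessel functions agree; monotonicity in the order, Turán's inequality and Amos' ratio bounds for the integral-defined one

Topic `Literature/Analysis/FunctionSpaces`, a proofs sibling of `BesselMoments.lean` /
`BesselIGeneratingFunction.lean`.  The tree carries TWO definitions of the modified Bessel function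
of the first kind of integer order:

* `Literature.Analysis.FunctionSpaces.besselI (n : ℕ) (x : ℝ)` — the angular integral DLMF 10.32.3
  (`BesselMoments.lean`; power series proved in `BesselIGeneratingFunction.lean`,
  `hasSum_besselI`), used by the lattice-gauge oracle files of the venture `LatticeQCDFlow`;
* `Literature.Probability.LatticeModels.besselI (m : ℤ) (x : ℝ)` — the power series DLMF 10.25.2
  (`GinibreCharacterExpansion.lean`), for which `GinibreBesselBounds.lean` and
  `BesselIRatioBounds.lean` prove Turán's inequality, monotonicity in the order, Amos' two-sided
  ratio bounds and the Gaussian bounds.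

This file proves that they are THE SAME FUNCTION (`besselI_eq_latticeModels_besselI`,
`latticeModels_besselI_eq_besselI_natAbs`; DLMF states 10.32.3 for the function defined by 10.25.2)
and transports the order-structure results to the integral-defined `besselI`:

* `besselI_succ_le` / `besselI_antitone` / `besselI_le_besselI_of_le` — **`n ↦ I_n(x)` is
  non-increasing** for `x ≥ 0` (Soni 1965; DLMF §10.37), and `besselI_succ_lt` /
  `besselI_strictAnti` — strictly decreasing for `x > 0`;
* `besselI_mul_besselI_add_two_le_sq` — Turán's inequality `I_n I_{n+2} ≤ I_{n+1}²` (all real `x`);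
* `besselI_succ_le_div_mul` — the termwise ratio bound `I_{n+1}(x) ≤ x/(2(n+1))·I_n(x)`, and
  `besselI_le_pow_div_factorial_mul` — `I_n(x) ≤ (x/2)ⁿ/n!·I₀(x)` (`x ≥ 0`);
* `add_mul_besselI_succ_le'` — Amos' handy upper ratio bound `(x + n)·I_{n+1}(x) ≤ x·I_n(x)`,
  and `besselI_div_besselI_zero_mem_Icc'` — the two-sided Gaussian bounds
  `e^{−n(n+1)/(2x)} ≤ I_n(x)/I₀(x) ≤ e^{−n(n−1)/(2(x+n))}` (`x > 0`).

(`I_n(x) > 0` for `x > 0` is already `Summit.Ventures.LatticeQCDFlow.Scoring.besselI_pos` on the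
Summits side and `Probability.LatticeModels.besselI_pos` here; it is used inline, not restated.)

Everything is proved; no definition and no named fact is introduced.  NOT here: non-integer order
(Soni's theorem is stated for real `ν ≥ 0`); the monotonicity of `K_ν` in the order.

## References

* NIST DLMF §10.25.2 (series), §10.32.3 (integral), §10.37 (monotonicity in the order). [`DLMF`]
* R. P. Soni, *On an inequality for modified Bessel functions*, J. Math. and Phys. 44 (1965)
  406–407, doi:10.1002/sapm1965441406 (`I_{ν+1}(x) < I_ν(x)`, `x > 0`).
* D. E. Amos, Math. Comp. 28 (1974) 239–251, (9)–(11) p. 241 (through `BesselIRatioBounds.lean`).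
-/

noncomputable section

open Real

namespace Literature.Analysis.FunctionSpaces

/-! ### 1. The two definitions agree -/

/-- **DLMF 10.32.3 = DLMF 10.25.2 at integer order**: the integral-defined
`I_n(x) = π⁻¹ ∫₀^π e^{x cos θ} cos(nθ) dθ` of `BesselMoments.lean` equals the series-defined
`I_n(x) = Σ_k (x/2)^{2k+n}/(k!(k+n)!)` of `Literature.Probability.LatticeModels` (both sums of the
same series: `hasSum_besselI`, `hasSum_besselITerm`). [cite: DLMF, 10.32.3] -/
theorem besselI_eq_latticeModels_besselI (n : ℕ) (x : ℝ) :
    besselI n x = Probability.LatticeModels.besselI (n : ℤ) x := by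
  refine (hasSum_besselI n x).unique ?_
  have h := Probability.LatticeModels.hasSum_besselITerm (n : ℤ) x
  have hfun : Probability.LatticeModels.besselITerm (n : ℤ) x =
      fun k : ℕ => (x / 2) ^ (2 * k + n) / ((Nat.factorial k : ℝ) * (Nat.factorial (k + n) : ℝ)) :=
    funext fun k => Probability.LatticeModels.besselITerm_natCast n x k
  rw [hfun] at h
  exact h

/-- The series-defined `I_m` (`m ∈ ℤ`, even in `m`) is the integral-defined `I_{|m|}`.
[cite: DLMF, 10.32.3] -/
theorem latticeModels_besselI_eq_besselI_natAbs (m : ℤ) (x : ℝ) :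
    Probability.LatticeModels.besselI m x = besselI m.natAbs x := by
  rw [besselI_eq_latticeModels_besselI]
  rcases Int.natAbs_eq m with h | h
  · rw [← h]
  · conv_lhs => rw [h, Probability.LatticeModels.besselI_neg_index]

/-! ### 2. Monotonicity in the order -/

/-- **`I_{n+1}(x) ≤ I_n(x)` for `x ≥ 0`**: the modified Bessel functions decrease with the order
(Soni 1965; DLMF §10.37; here from the log-concavity `GinibreBesselBounds.besselI_natCast_succ_le_self`).
[cite: Soni1965, Theorem (p. 406)] -/
theorem besselI_succ_le (n : ℕ) {x : ℝ} (hx : 0 ≤ x) : besselI (n + 1) x ≤ besselI n x := by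
  rw [besselI_eq_latticeModels_besselI, besselI_eq_latticeModels_besselI]
  exact Probability.LatticeModels.besselI_natCast_succ_le_self hx n

/-- `n ↦ I_n(x)` is antitone for `x ≥ 0`. [cite: Soni1965, Theorem (p. 406)] -/
theorem besselI_antitone {x : ℝ} (hx : 0 ≤ x) : Antitone fun n : ℕ => besselI n x :=
  antitone_nat_of_succ_le fun n => besselI_succ_le n hx

/-- `I_n(x) ≤ I_m(x)` for `m ≤ n` and `x ≥ 0`. [cite: Soni1965, Theorem (p. 406)] -/
theorem besselI_le_besselI_of_le {m n : ℕ} (h : m ≤ n) {x : ℝ} (hx : 0 ≤ x) :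
    besselI n x ≤ besselI m x :=
  besselI_antitone hx h

/-- **Amos' handy upper ratio bound** `(x + n)·I_{n+1}(x) ≤ x·I_n(x)` (`x > 0`), i.e.
`I_{n+1}/I_n ≤ x/(x+n)` (a weakening of `I_{n+1}/I_n ≤ x/(n + √(x² + (n+2)²))`).
[cite: Amos1974, (11) p. 241] -/
theorem add_mul_besselI_succ_le' (n : ℕ) {x : ℝ} (hx : 0 < x) :
    (x + n) * besselI (n + 1) x ≤ x * besselI n x := by
  rw [besselI_eq_latticeModels_besselI, besselI_eq_latticeModels_besselI]
  exact Probability.LatticeModels.add_mul_besselI_succ_le hx n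

/-- **`I_{n+1}(x) < I_n(x)` for `x > 0`** (strict monotonicity in the order, Soni 1965): from
Amos' bound `(n + √(x² + (n+2)²))·I_{n+1} ≤ x·I_n` and `x < n + √(x² + (n+2)²)`, `I_{n+1} > 0`.
[cite: Soni1965, Theorem (p. 406)] -/
theorem besselI_succ_lt (n : ℕ) {x : ℝ} (hx : 0 < x) : besselI (n + 1) x < besselI n x := by
  have h := Probability.LatticeModels.mul_besselI_succ_le_mul_besselI hx n
  rw [← besselI_eq_latticeModels_besselI, ← besselI_eq_latticeModels_besselI] at h
  have hB : 0 < besselI (n + 1) x := by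
    rw [besselI_eq_latticeModels_besselI]
    exact Probability.LatticeModels.besselI_pos hx _
  have hs : x < (n : ℝ) + Real.sqrt (x ^ 2 + (n + 2) ^ 2) := by
    have h1 : x < Real.sqrt (x ^ 2 + (n + 2) ^ 2) := by
      calc x = Real.sqrt (x ^ 2) := (Real.sqrt_sq hx.le).symm
        _ < Real.sqrt (x ^ 2 + (n + 2) ^ 2) :=
          Real.sqrt_lt_sqrt (sq_nonneg x) (lt_add_of_pos_right _ (by positivity))
    have h2 : (0 : ℝ) ≤ n := n.cast_nonneg
    linarith
  have h3 : x * besselI (n + 1) x < ((n : ℝ) + Real.sqrt (x ^ 2 + (n + 2) ^ 2)) * besselI (n + 1) x :=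
    mul_lt_mul_of_pos_right hs hB
  exact lt_of_mul_lt_mul_left (h3.trans_le h) hx.le

/-- `n ↦ I_n(x)` is strictly antitone for `x > 0`. [cite: Soni1965, Theorem (p. 406)] -/
theorem besselI_strictAnti {x : ℝ} (hx : 0 < x) : StrictAnti fun n : ℕ => besselI n x :=
  strictAnti_nat_of_succ_lt fun n => besselI_succ_lt n hx

/-! ### 3. Turán's inequality and the termwise bounds -/

/-- **Turán's inequality** `I_n(x)·I_{n+2}(x) ≤ I_{n+1}(x)²` for every real `x`
(Thiruvenkatachar–Nanjundiah 1951; termwise from the product formula,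
`BesselIRatioBounds.besselI_mul_besselI_add_two_le_sq`). [cite: Segura2011, Theorem 7 (44) p. 522] -/
theorem besselI_mul_besselI_add_two_le_sq (n : ℕ) (x : ℝ) :
    besselI n x * besselI (n + 2) x ≤ besselI (n + 1) x ^ 2 := by
  rw [besselI_eq_latticeModels_besselI, besselI_eq_latticeModels_besselI,
    besselI_eq_latticeModels_besselI]
  exact Probability.LatticeModels.besselI_mul_besselI_add_two_le_sq n x

/-- The termwise ratio bound `I_{n+1}(x) ≤ x/(2(n+1))·I_n(x)` (`x ≥ 0`; the series 9.6.10 of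
Abramowitz–Stegun compared term by term; also a weakening of Amos' (11)).
[cite: AbramowitzStegun1964, 9.6.10 (series of `I_ν`; termwise comparison)] -/
theorem besselI_succ_le_div_mul (n : ℕ) {x : ℝ} (hx : 0 ≤ x) :
    besselI (n + 1) x ≤ x / (2 * (n + 1)) * besselI n x := by
  rw [besselI_eq_latticeModels_besselI, besselI_eq_latticeModels_besselI]
  exact Probability.LatticeModels.besselI_natCast_succ_le hx n

/-- The factorial bound `I_n(x) ≤ (x/2)ⁿ/n!·I₀(x)` (`x ≥ 0`; the termwise ratio bound iterated).
[cite: AbramowitzStegun1964, 9.6.10 (series of `I_ν`; termwise comparison)] -/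
theorem besselI_le_pow_div_factorial_mul (n : ℕ) {x : ℝ} (hx : 0 ≤ x) :
    besselI n x ≤ (x / 2) ^ n / (Nat.factorial n) * besselI 0 x := by
  rw [besselI_eq_latticeModels_besselI n, besselI_eq_latticeModels_besselI 0]
  exact_mod_cast Probability.LatticeModels.besselI_natCast_le_pow_div_factorial_mul hx n

/-! ### 4. The two-sided Gaussian bounds -/

/-- **Two-sided Gaussian bounds** (Amos-type): for `x > 0` and every order `n`,
`e^{−n(n+1)/(2x)} ≤ I_n(x)/I₀(x) ≤ e^{−n(n−1)/(2(x+n))}` (products of the one-step ratio bounds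
(9) and (11)). [cite: Amos1974, (9)–(11) p. 241] -/
theorem besselI_div_besselI_zero_mem_Icc' (n : ℕ) {x : ℝ} (hx : 0 < x) :
    besselI n x / besselI 0 x ∈ Set.Icc
      (Real.exp (-(n * (n + 1) / (2 * x)))) (Real.exp (-(n * (n - 1) / (2 * (x + n))))) := by
  have h := Probability.LatticeModels.besselI_div_besselI_zero_mem_Icc hx (n : ℤ)
  rw [← besselI_eq_latticeModels_besselI] at h
  have h0 : Probability.LatticeModels.besselI 0 x = besselI 0 x :=
    (besselI_eq_latticeModels_besselI 0 x).symm
  rw [h0] at h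
  simpa only [Int.natAbs_natCast] using h

end Literature.Analysis.FunctionSpaces
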